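import Mathlib
import HarnessLib
import Summits.HubbardSuperconductivity.HubbardSuperconductivity.Theorems.KLProgrammeC4aPartnerBandCooperDefect
import Summits.HubbardSuperconductivity.HubbardSuperconductivity.Theorems.KLProgrammeC4aPartnerBandCrossings

/-!
# Route `KLProgramme` — crux C4a, S3 brick (B4)/(B5) «(B4)-ABS-BUBBLE», part 7: the COOPER SLOPE CEILING row — the loop-angle slope of the pp partner band
# is `O(|ρ| + |ϑ − π|)` uniformly in the loop: `|∂_φ ē(e,φ;ρ,ϑ,θ)| ≤ K₂·msD₁·(|ρ|/(Dt−2A) + msD₁·|ϑ − π|)`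

Cell `gate-hubbard-kl`, seat hubbard-kl-k3c3-p3 (g26; row «implicit-function / monotonicity route for μ(n)»).  Located brick for the (C)-closer lane
hubbard-kl-c4a-1 (stub (C) `stub_twoLeg_curvature` of `KLRegimeEngineV17F2`, stmt-HubbardSuperconductivity-20437), HOME/hubbard-kl-k3c3-p3/B4-ABS-BUBBLE.md §3
row (r1): the scaled slope CEILING `|∂_φē| ≤ L̂₁·r` (`r ≍ |ρ| + |ϑ − π|`) that `integral_inv_envelope_le_cooper` / `level_loop_inv_envelope_le_cooper` take as `hL`.
Loop-angle twin of `…C4aPartnerBandCooperDefect.abs_deriv_partnerBand_pp_le` (c4a-1 g6, the FLOW-TIME slope): the pair-sum `S = Φ(0,θ) + Φ(ρ,ϑ+θ)` does not move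
with the loop angle, so only the `K₂·‖S‖` term survives —

  **`abs_deriv_partnerBand_pp_angle_le_cooper`**: `|∂_φ e_K(S − Φ(e,φ+θ))| ≤ K₂·(|ρ|/(Dt−2A) + msD₁·|ϑ − π|)·msD₁`

(`∂_φ e_K(S − Φ(e,φ+θ)) = −De_K(S − Φ)[∂_sΦ]` by `…C4aPartnerBandCrossings.hasDerivAt_partnerBand_pp_angle`; at `S = 0` the composite `e_K(−Φ(e,·+θ)) ≡ e` is constant
(`frameLevel_neg_levelPoint_tube`), so `De_K(−Φ)[∂_sΦ] = 0`; the difference of the two differentials is `≤ K₂‖S‖` (`norm_fderiv_frameLevel_sub_le`) and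
`‖S‖ ≤ |ρ|/(Dt−2A) + msD₁|ϑ − π|` (`…C4aPathRigidity.norm_pairSumPath_zero_le`), `‖∂_sΦ‖ ≤ msD₁`).  Binder shape = `…C4aPartnerBandCooperDefect`.
Pure calculus on landed objects; nothing about the model's sizes; nothing asserts (C), K3 or superconductivity.
References: FST II CPAM 51 (1998) §3 Thm 3.5 [cite: FeldmanSalmhoferTrubowitz1998]; BGM 2006 §2.4 (2.40) [cite: BenfattoGiulianiMastropietro2006].
-/

noncomputable section

namespace Summit.HubbardSuperconductivity.HubbardSuperconductivity.Theorems.C4a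

set_option linter.dupNamespace false -- summit = problem name (single-conjunct summit), D-0017

open Real Set Filter
open scoped Topology
open Literature.MathematicalPhysics.QuantumLattice Literature.MathematicalPhysics.QuantumLattice.BandSectorCounting
open Summit.HubbardSuperconductivity.HubbardSuperconductivity.Theorems.KLRegimeSplit
open Summit.HubbardSuperconductivity.HubbardSuperconductivity.Theorems.DispersionFlow
open Summit.HubbardSuperconductivity.HubbardSuperconductivity.Theorems.PerturbedFermiCurve

section Sizes

variable {K : TrigPolyC4v} {A : ℝ} (hA : ∀ p : Momentum, ∀ j ≤ 2, ‖iteratedFDeriv ℝ j (frameShift K) p‖ ≤ A) (hA20 : A ≤ 1 / 20)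
  (hd : klCurveD ≤ (bandBounds (show (-4 : ℝ) < -1.1 by norm_num) (show (-1.1 : ℝ) ≤ -0.1 by norm_num)
    (show (-0.1 : ℝ) < 0 by norm_num)).Dtmin - 2 * A)
  {μ r : ℝ} (hr : 0 < r) (hlo : (-1.1 : ℝ) < μ - r - A) (hhi : μ + r + A < -0.1)
  {A₃ A₄ : ℝ} (hA₃ : ∀ p : Momentum, ‖iteratedFDeriv ℝ 3 (frameShift K) p‖ ≤ A₃)
  (hA₄ : ∀ p : Momentum, ‖iteratedFDeriv ℝ 4 (frameShift K) p‖ ≤ A₄)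
  {K₂ : ℝ} (hK₂ : ∀ p : Momentum, ‖iteratedFDeriv ℝ 2 (frameLevel μ K) p‖ ≤ K₂)
include hA hA20 hd hr hlo hhi hA₃ hA₄ hK₂

/-- **THE COOPER SLOPE CEILING** (loop-angle slope of the pp partner band near the Cooper configuration): for every loop level `|e| < r`, loop angle `φ`,
offset `|ρ| < r`, pair angle `ϑ` and base angle `θ`,
`|∂_φ e_K(S − Φ(e,φ+θ))| ≤ K₂·(|ρ|/(Dt−2A) + msD₁·|ϑ − π|)·msD₁` — the slope vanishes identically at the Cooper configuration (`S = 0`: the loop stays on its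
own level set) and is Lipschitz in the pair-sum `S`.  This is the `hL` row (`|∂ₓG e x| ≤ L̂₁·r`) of `…C4aEnvelopeLevelLayers.integral_inv_envelope_le_cooper`.
[cite: FeldmanSalmhoferTrubowitz1998, §3 Thm 3.5] -/
theorem abs_deriv_partnerBand_pp_angle_le_cooper {ρ : ℝ} (hρ : |ρ| < r) {e : ℝ} (he : |e| < r) (ϑ θ φ : ℝ) :
    |deriv (fun x : ℝ => frameLevel μ K (pairSumPath μ K ρ ϑ θ 0 - levelPoint μ K e (x + θ))) φ| ≤
      K₂ * (|ρ| / ((bandBounds (show (-4 : ℝ) < -1.1 by norm_num) (show (-1.1 : ℝ) ≤ -0.1 by norm_num) (show (-0.1 : ℝ) < 0 by norm_num)).Dtmin - 2 * A) +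
          msD A₃ A₄ 1 * |ϑ - π|) * msD A₃ A₄ 1 := by
  set B₀ := bandBounds (show (-4 : ℝ) < -1.1 by norm_num) (show (-1.1 : ℝ) ≤ -0.1 by norm_num) (show (-0.1 : ℝ) < 0 by norm_num) with hB₀
  have hK₂0 : 0 ≤ K₂ := (norm_nonneg _).trans (hK₂ 0)
  set S : Momentum := pairSumPath μ K ρ ϑ θ 0 with hSdef
  set v : Momentum := iteratedDeriv 1 (levelPoint μ K e) (φ + θ) with hvdef
  set p : Momentum := levelPoint μ K e (φ + θ) with hpdef
  -- the slope at the actual configuration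
  have hder := (hasDerivAt_partnerBand_pp_angle hA hd hlo hhi (ρ := ρ) he ϑ θ φ).deriv
  -- the slope at the Cooper configuration vanishes: the composite `x ↦ e_K(0 − Φ(e,x+θ)) ≡ e`
  have hcoop := hasDerivAt_partnerBand_pp_angle hA hd hlo hhi (ρ := (0 : ℝ)) he π θ φ
  rw [pairSumPath_cooper] at hcoop
  have hconst : HasDerivAt (fun x : ℝ => frameLevel μ K ((0 : Momentum) - levelPoint μ K e (x + θ))) 0 φ := by
    have hfun : (fun x : ℝ => frameLevel μ K ((0 : Momentum) - levelPoint μ K e (x + θ))) = fun _ => e :=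
      funext fun x => by rw [zero_sub]; exact frameLevel_neg_levelPoint_tube hA hlo hhi he (x + θ)
    rw [hfun]; exact hasDerivAt_const φ e
  have hzero : -fderiv ℝ (frameLevel μ K) ((0 : Momentum) - p) v = 0 := hcoop.unique hconst
  have hzero' : fderiv ℝ (frameLevel μ K) ((0 : Momentum) - p) v = 0 := by rwa [neg_eq_zero] at hzero
  -- rearrange around the reference differential
  have hval : deriv (fun x : ℝ => frameLevel μ K (pairSumPath μ K ρ ϑ θ 0 - levelPoint μ K e (x + θ))) φ =
      -((fderiv ℝ (frameLevel μ K) (S - p) - fderiv ℝ (frameLevel μ K) ((0 : Momentum) - p)) v) := by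
    rw [hder, show (fderiv ℝ (frameLevel μ K) (S - p) - fderiv ℝ (frameLevel μ K) ((0 : Momentum) - p)) v =
        fderiv ℝ (frameLevel μ K) (S - p) v - fderiv ℝ (frameLevel μ K) ((0 : Momentum) - p) v from rfl, hzero', sub_zero]
  -- sizes
  have hS0 : ‖S‖ ≤ |ρ| / (B₀.Dtmin - 2 * A) + msD A₃ A₄ 1 * |ϑ - π| := norm_pairSumPath_zero_le hA hA20 hd hr hlo hhi hA₃ hA₄ hρ ϑ θ
  have hv : ‖v‖ ≤ msD A₃ A₄ 1 := norm_iteratedDeriv_levelPoint_le hA hA20 hd hlo hhi hA₃ hA₄ he (i := 1) le_rfl (by norm_num) (φ + θ)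
  have hL : ‖fderiv ℝ (frameLevel μ K) (S - p) - fderiv ℝ (frameLevel μ K) ((0 : Momentum) - p)‖ ≤ K₂ * ‖S‖ := by
    have h := norm_fderiv_frameLevel_sub_le hK₂ (S - p) ((0 : Momentum) - p)
    rwa [show S - p - ((0 : Momentum) - p) = S by abel] at h
  rw [hval, abs_neg, ← Real.norm_eq_abs]
  calc ‖(fderiv ℝ (frameLevel μ K) (S - p) - fderiv ℝ (frameLevel μ K) ((0 : Momentum) - p)) v‖
      ≤ ‖fderiv ℝ (frameLevel μ K) (S - p) - fderiv ℝ (frameLevel μ K) ((0 : Momentum) - p)‖ * ‖v‖ := ContinuousLinearMap.le_opNorm _ _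
    _ ≤ K₂ * ‖S‖ * msD A₃ A₄ 1 := mul_le_mul hL hv (norm_nonneg _) (by positivity)
    _ ≤ K₂ * (|ρ| / (B₀.Dtmin - 2 * A) + msD A₃ A₄ 1 * |ϑ - π|) * msD A₃ A₄ 1 :=
        mul_le_mul_of_nonneg_right (mul_le_mul_of_nonneg_left hS0 hK₂0) ((norm_nonneg _).trans hv)

end Sizes

end Summit.HubbardSuperconductivity.HubbardSuperconductivity.Theorems.C4a

end
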